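import Summits.FinalStateConjecture.FinalStateConjecture.Theorems.EIHFluxBalanceInertialRecessionStubEndgameBasics

/-!
# Route EIHFluxBalance — crux `InertialRecession`, abstract endgame for general `N`:
# slaved subluminal centres eventually move at speed at most one

Helper file for the crux `stmt-FinalStateConjecture-10166` (virial route; supplies the hypothesis `hmove` of
`…VirialClusterLaw.clusterLaw_constPath`). From the hypotheses of `stub_pairwiseDichotomy` — `ξᵢ` differentiable, `‖vᵢ‖ ≤ k < 1`,
`ξ̇ᵢ − vᵢ → 0` — every centre eventually satisfies `‖ξ̇ᵢ‖ ≤ 1`, hence `‖ξᵢ s′ − ξᵢ s‖ ≤ s′ − s` for `T ≤ s ≤ s′` (mean value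
inequality), with ONE `T` for all `i : Fin N`. Mathlib-only.
-/

noncomputable section

set_option linter.dupNamespace false

open Filter Topology Set

namespace Summit.FinalStateConjecture.FinalStateConjecture.Theorems.SublinearIsFree.Virial

open Literature.Geometry.Lorentzian

/-- **Eventually unit speed.** If `ξ : ℝ → E3` is differentiable, `‖v t‖ ≤ k < 1` for all `t`, and `ξ̇ − v → 0`, then there is
`T` with `‖ξ s′ − ξ s‖ ≤ s′ − s` whenever `T ≤ s ≤ s′`. [folklore] -/
theorem exists_norm_sub_le_sub_of_slaved {ξ v : ℝ → E3} {k : ℝ} (hξ : Differentiable ℝ ξ) (hk : k < 1)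
    (hv : ∀ t, ‖v t‖ ≤ k) (hslave : Tendsto (fun t ↦ deriv ξ t - v t) atTop (𝓝 0)) :
    ∃ T : ℝ, ∀ s s' : ℝ, T ≤ s → s ≤ s' → ‖ξ s' - ξ s‖ ≤ s' - s := by
  have hε : 0 < 1 - k := by linarith
  obtain ⟨T, hT⟩ := (Metric.tendsto_atTop.mp hslave) (1 - k) hε
  refine ⟨T, fun s s' hs hss' ↦ ?_⟩
  have hderiv : ∀ u ∈ Set.Ico s s', ‖deriv ξ u‖ ≤ 1 := by
    intro u hu
    have h1 := hT u (hs.trans hu.1)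
    rw [dist_eq_norm, sub_zero] at h1
    calc ‖deriv ξ u‖ = ‖(deriv ξ u - v u) + v u‖ := by rw [sub_add_cancel]
      _ ≤ ‖deriv ξ u - v u‖ + ‖v u‖ := norm_add_le _ _
      _ ≤ (1 - k) + k := add_le_add h1.le (hv u)
      _ = 1 := by ring
  have h := norm_image_sub_le_of_norm_deriv_le_segment' (f := ξ) (a := s) (b := s')
    (fun u _ ↦ (hξ u).hasDerivAt.hasDerivWithinAt) hderiv s' (right_mem_Icc.mpr hss')
  simpa using h

/-- **Uniform version for finitely many centres.** Under the kinematic hypotheses of `stub_pairwiseDichotomy` there is ONE `T`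
such that every centre moves by at most `s′ − s` on `[s, s′] ⊆ [T, ∞)`. [folklore] -/
theorem exists_forall_norm_sub_le_sub_of_slaved' {N : ℕ} {ξ v : Fin N → ℝ → E3} (hξ : ∀ i, Differentiable ℝ (ξ i))
    (hk : ∃ k : ℝ, 0 ≤ k ∧ k < 1 ∧ ∀ i t, ‖v i t‖ ≤ k)
    (hslave : ∀ i, Tendsto (fun t ↦ deriv (ξ i) t - v i t) atTop (𝓝 0)) :
    ∃ T : ℝ, ∀ i (s s' : ℝ), T ≤ s → s ≤ s' → ‖ξ i s' - ξ i s‖ ≤ s' - s := by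
  obtain ⟨k, -, hk1, hvk⟩ := hk
  have h : ∀ i, ∃ T : ℝ, ∀ s s' : ℝ, T ≤ s → s ≤ s' → ‖ξ i s' - ξ i s‖ ≤ s' - s := fun i ↦
    exists_norm_sub_le_sub_of_slaved (hξ i) hk1 (hvk i) (hslave i)
  choose T hT using h
  rcases Nat.eq_zero_or_pos N with hN | hN
  · subst hN
    exact ⟨0, fun i ↦ i.elim0⟩
  · haveI : Nonempty (Fin N) := ⟨⟨0, hN⟩⟩
    refine ⟨Finset.univ.sup' Finset.univ_nonempty T, fun i s s' hs hss' ↦ hT i s s' ?_ hss'⟩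
    exact (Finset.le_sup' T (Finset.mem_univ i)).trans hs

/-- Registered stub `exists_forall_norm_sub_le_sub_of_slaved` (crux `stmt-FinalStateConjecture-10166`): slaved subluminal centres
eventually move at speed `≤ 1`, uniformly in `i`; one-line form of `exists_forall_norm_sub_le_sub_of_slaved'`. [folklore] -/
theorem exists_forall_norm_sub_le_sub_of_slaved : open Literature.Geometry.Lorentzian Filter Topology in ∀ {N : ℕ} {ξ v : Fin N → ℝ → E3}, (∀ i, Differentiable ℝ (ξ i)) → (∃ k : ℝ, 0 ≤ k ∧ k < 1 ∧ ∀ i t, ‖v i t‖ ≤ k) → (∀ i, Tendsto (fun t ↦ deriv (ξ i) t - v i t) atTop (𝓝 0)) → ∃ T : ℝ, ∀ i (s s' : ℝ), T ≤ s → s ≤ s' → ‖ξ i s' - ξ i s‖ ≤ s' - s :=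
  fun hξ hk hslave ↦ exists_forall_norm_sub_le_sub_of_slaved' hξ hk hslave

end Summit.FinalStateConjecture.FinalStateConjecture.Theorems.SublinearIsFree.Virial

end
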